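import Summits.QuantumFields.YangMills.Theorems.LuscherReductionRunningReductionCoarseUpperDefs
import Summits.QuantumFields.YangMills.Theorems.LuscherReductionRunningReductionCoarseUpperPrelim
import Summits.QuantumFields.YangMills.Theorems.LuscherReductionOneSiteLevelsClosed
import HarnessLib

/-!
# COARSE-UPPER(L) ⇐ VALLEY GAIN + INNER NO-INTRUDER: the glue, kernel-checked (fixed-lattice programme COARSE(L₀) — route `LuscherReduction`,
# crux RED stmt-QuantumFields-19978 KT-door 3b′ / crux `TwistedTraceScaling` stmt-QuantumFields-20203 S-BASE; design note
# `pub/ym-fleet/ym-luscher-20007-p1/COARSE-DESIGN.md` §7–§8)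

THEOREM `boUpper_of_valley_inner : ScalesAdmissible L δ η → ValleyGainAt L δ η → InnerNoIntruderAt L δ → BOUpperAt L` and, with crux ONE closed
(`oneSiteLevels_proof`) and the tree's `BOHandover.coarseNoIntruderAt_of_boUpper`, `coarseNoIntruderAt_of_valley_inner` = VERBATIM the body of
KTR's `CoarseNoIntruderAt L` (= hypothesis `hUp` of `TwoLattice.Base.fixedLatticeTraceLaw_of_coarse`; stub 3b′ is `L = 2`).  So COARSE-UPPER(L)
is reduced to the two target texts of `…CoarseUpperDefs` (C3 VALLEY `ValleyGainAt`, C4 INNER `InnerNoIntruderAt`) at any admissible pair of IMS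
scales — nothing else.
Proof (IMS in subspace mode, as the closed child `OneSiteTail`): fix `k, ε`; at large `β` suppose `λ_k μ₀ > e^{ελ_b} μ_k λ₀`.  For `ψ` in the
span of the exact eigenfamily `e₀…e_k` (`exists_isPhys_eigenfamily_of_pos`): `λ_k‖ψ‖² ≤ ⟨ψ,Kψ⟩ ≤ ⟨ψ_in,Kψ_in⟩ + ⟨ψ_val,Kψ_val⟩ + onionErr·c_β^{|E|}‖ψ‖²`
(onion), `⟨ψ_val,Kψ_val⟩ ≤ e^{−(Δ_k+1)λ_b}λ₀(‖ψ‖² − ‖ψ_in‖²)` (VALLEY at `A = Δ_k + 1`, `‖cos·ψ‖² + ‖sin·ψ‖² = ‖ψ‖²`), `onionErr·c_β^{|E|} ≤ κλ_bλ₀`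
(admissible scales + the β-uniform floor `levelValue_zero_ge_uniform`).  This forces `‖ψ_in‖ > 0` for `ψ ≠ 0` (the inner pieces `cos Θ_δ e_i`
have nondegenerate Gram matrix: `gram_endgame`), so INNER NO-INTRUDER supplies a combination with `⟨ψ_in,Kψ_in⟩μ₀ ≤ e^{(ε/2)λ_b}μ_kλ₀‖ψ_in‖²`;
the bound `λ_kμ₀ ≤ max(e^{(ε/2)λ_b}μ_k, e^{−(Δ_k+1)λ_b}μ₀)λ₀ + κλ_bλ₀μ₀ ≤ e^{ελ_b}μ_kλ₀` (ONE's lower bound `μ_k ≥ e^{−(Δ_kλ_b + Cλ_b²)}μ₀`,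
`endgame_a/b`, `bo_endgame`) is the contradiction.
HONEST FRAMING: a reduction; V(L) and I(L) are OPEN fixed-lattice semiclassics; femto rung R2b1; not infinite volume, not a gap, not Clay.
-/

set_option autoImplicit false

noncomputable section

open MeasureTheory Filter Topology Real
open scoped BigOperators
open Literature.MathematicalPhysics.QuantumFieldTheory
open Literature.MathematicalPhysics.QuantumLattice

namespace Summit.QuantumFields.YangMills.Theorems.FemtoTransferGap

variable {L : ℕ} [NeZero L]

/-! ## §4 BO_up(L) from VALLEY GAIN and INNER NO-INTRUDER -/

/-- ★★★ **`BO_up(L)` from `V(L)` and `I(L)`** at any admissible pair of IMS scales. [cite: Luscher1983, §3] [cite: SimonB1983DiscreteSpectrum, §3] -/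
theorem boUpper_of_valley_inner {δ η : ℝ → ℝ} (hS : ScalesAdmissible L δ η) (hV : ValleyGainAt L δ η) (hI : InnerNoIntruderAt L δ) :
    BOUpperAt L := by
  intro k ε hε
  obtain ⟨hδ, hη, hErr⟩ := hS
  obtain ⟨C, B0, hONE⟩ := oneSiteLevels_proof k
  obtain ⟨βV, hV'⟩ := hV (levelGap k + 1)
  obtain ⟨βI, hI'⟩ := hI k (ε / 2) (half_pos hε)
  have hκ0 : 0 < min (ε / 8) (1 / 8) := lt_min (by positivity) (by norm_num)
  have hκε : min (ε / 8) (1 / 8) ≤ ε / 4 := (min_le_left _ _).trans (by linarith)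
  have hκ4 : min (ε / 8) (1 / 8) ≤ 1 / 4 := (min_le_right _ _).trans (by norm_num)
  obtain ⟨βE, hE⟩ := hErr (min (ε / 8) (1 / 8)) hκ0
  have hτ0 : 0 < 1 / (2 * (|levelGap k| + |C| + 2)) := by positivity
  refine ⟨max (max 1 B0) (max (max βV βI) (max βE (2 / (1 / (2 * (|levelGap k| + |C| + 2))) ^ 3))), fun β hβ => ?_⟩
  have hβ1 : 1 ≤ β := ((le_max_left _ _).trans (le_max_left _ _)).trans hβ
  have hβ0 : 0 < β := by linarith
  have hβB0 : B0 ≤ β := ((le_max_right _ _).trans (le_max_left _ _)).trans hβ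
  have hβV : βV ≤ β := (((le_max_left _ _).trans (le_max_left _ _)).trans (le_max_right _ _)).trans hβ
  have hβI : βI ≤ β := (((le_max_right _ _).trans (le_max_left _ _)).trans (le_max_right _ _)).trans hβ
  have hβE : βE ≤ β := (((le_max_left _ _).trans (le_max_right _ _)).trans (le_max_right _ _)).trans hβ
  have hβτ : 2 / (1 / (2 * (|levelGap k| + |C| + 2))) ^ 3 ≤ β :=
    (((le_max_right _ _).trans (le_max_right _ _)).trans (le_max_right _ _)).trans hβ
  -- the natural coupling and the one-site levels
  have hL1 : (1 : ℝ) ≤ (L : ℝ) ^ 3 := one_le_pow₀ (by exact_mod_cast NeZero.one_le)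
  have hB'β : β ≤ (L : ℝ) ^ 3 * β := by nlinarith
  have hB'0 : 0 < (L : ℝ) ^ 3 * β := lt_of_lt_of_le hβ0 hB'β
  obtain ⟨hμ0, -, hμk⟩ := hONE ((L : ℝ) ^ 3 * β) (hβB0.trans hB'β)
  have hlam0 : 0 < bareLambda ((L : ℝ) ^ 3 * β) := bareLambda_pos' hB'0
  have hlamτ : bareLambda ((L : ℝ) ^ 3 * β) ≤ 1 / (2 * (|levelGap k| + |C| + 2)) := bareLambda_cube_le (L := L) hτ0 hβτ
  have hΛ0 : 0 < levelValue su2Rep L β 0 := levelValue_su2Rep_pos hβ0 0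
  obtain ⟨h1, h2, hy⟩ := smallness_of_le hlam0.le hlamτ
  -- ONE's lower bound with `|C|`, and `μ_k ≥ μ₀/2`
  have hμk' : Real.exp (-(levelGap k * bareLambda ((L : ℝ) ^ 3 * β) + |C| * bareLambda ((L : ℝ) ^ 3 * β) ^ 2)) *
      levelValue su2Rep 1 ((L : ℝ) ^ 3 * β) 0 ≤ levelValue su2Rep 1 ((L : ℝ) ^ 3 * β) k := by
    refine le_trans (mul_le_mul_of_nonneg_right (Real.exp_le_exp.2 ?_) hμ0.le) hμk
    have := mul_le_mul_of_nonneg_right (le_abs_self C) (sq_nonneg (bareLambda ((L : ℝ) ^ 3 * β)))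
    linarith
  have hμk2 := half_le_of_exp_lower hy hμ0.le hμk'
  -- the error budget through the floor
  have herr : onionErr L β (δ β) (η β) * latCE L β ≤
      min (ε / 8) (1 / 8) * bareLambda ((L : ℝ) ^ 3 * β) * levelValue su2Rep L β 0 := by
    have h := mul_le_mul_of_nonneg_right (hE β hβE) (latCE_pos (L := L) hβ0.le).le
    refine h.trans ?_
    rw [mul_assoc (min (ε / 8) (1 / 8) * bareLambda ((L : ℝ) ^ 3 * β))]
    exact mul_le_mul_of_nonneg_left (levelValue_zero_ge_uniform hβ1) (by positivity)
  -- endgame targets (a), (b)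
  have hA := endgame_a hε.le hlam0.le hμ0.le hμk2 hκε
  have hB := endgame_b hε.le hlam0.le h1 h2 hμ0.le hμk' hκ4
  -- suppose BO_up fails at `β`
  by_contra H
  push Not at H
  -- the exact eigenfamily and its inner pieces
  obtain ⟨e, he, hon, heig⟩ := exists_isPhys_eigenfamily_of_pos (L := L) hβ0 k
  obtain ⟨F, hFdef⟩ : ∃ F : Fin (k + 1) → GaugeConfig 3 L SU2 → ℝ, F = fun i U => Real.cos (innerPhase (δ β) U) * e i U := ⟨_, rfl⟩
  have hFphys : ∀ i, IsPhys (F i) := fun i => by rw [hFdef]; exact isPhys_inner (δ β) (he i)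
  have hFsupp : ∀ i U, F i U ≠ 0 → ∃ z : Fin 3 → Bool, orbitDist (TT.twist3 z U) < δ β := fun i U h => by
    rw [hFdef] at h
    exact exists_orbitDist_lt_of_cos_ne_zero (hδ β) (left_ne_zero_of_mul h)
  -- KEY ESTIMATE for every coefficient vector
  have key : ∀ a : Fin (k + 1) → ℝ,
      0 ≤ l2 (fun U => ∑ i, a i * F i U) (fun U => ∑ i, a i * F i U) ∧
      l2 (fun U => ∑ i, a i * F i U) (fun U => ∑ i, a i * F i U) ≤ ∑ i, a i ^ 2 ∧
      levelValue su2Rep L β k * levelValue su2Rep 1 ((L : ℝ) ^ 3 * β) 0 * ∑ i, a i ^ 2 ≤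
        qform su2Rep β (fun U => ∑ i, a i * F i U) (fun U => ∑ i, a i * F i U) * levelValue su2Rep 1 ((L : ℝ) ^ 3 * β) 0
          + Real.exp (-((levelGap k + 1) * bareLambda ((L : ℝ) ^ 3 * β))) * levelValue su2Rep L β 0 *
              levelValue su2Rep 1 ((L : ℝ) ^ 3 * β) 0 * (∑ i, a i ^ 2 - l2 (fun U => ∑ i, a i * F i U) (fun U => ∑ i, a i * F i U))
          + min (ε / 8) (1 / 8) * bareLambda ((L : ℝ) ^ 3 * β) * levelValue su2Rep L β 0 * levelValue su2Rep 1 ((L : ℝ) ^ 3 * β) 0 *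
              ∑ i, a i ^ 2 := by
    intro a
    have hψ : IsPhys (fun U => ∑ i, a i * e i U) := isPhys_sum_mul_lat Finset.univ e he a
    obtain ⟨hn, hq⟩ := forms_of_eigenfamily_lat he hon heig a
    -- the inner piece of `ψ` is the combination of the `F i`
    have hin : (fun U => Real.cos (innerPhase (δ β) U) * ∑ i, a i * e i U) = fun U => ∑ i, a i * F i U := by
      rw [hFdef]; exact cut_sum_mul _ a e
    -- onion
    have honion := qform_le_three_regions_onionErr hβ0 (hδ β) (hη β) hψ
    rw [hin, hn] at honion
    -- valley
    have hψoutP : IsPhys (fun U => Real.sin (innerPhase (δ β) U) * ∑ i, a i * e i U) := isPhys_outer (δ β) hψ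
    have hVal := hV' β hβV _ (isPhys_valley (η β) hψoutP) fun U hU =>
      valley_support (hδ β) (hη β) (fun U => ∑ i, a i * e i U) hU
    have hvalout := l2_mul_le hψoutP (J := fun U => Real.cos (actionPhase (η β) U)) fun U => Real.abs_cos_le_one _
    have hsplit := l2_cos_add_l2_sin (measurable_innerPhase (δ β)) hψ
    rw [hin, hn] at hsplit
    -- floor of the span
    have hfloorK : levelValue su2Rep L β k * ∑ i, a i ^ 2 ≤ qform su2Rep β (fun U => ∑ i, a i * e i U) (fun U => ∑ i, a i * e i U) := by
      rw [hq, Finset.mul_sum]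
      refine Finset.sum_le_sum fun i _ => mul_le_mul_of_nonneg_right ?_ (sq_nonneg _)
      exact levelValue_le_of_le hβ0 (Nat.le_of_lt_succ i.2)
    have hnin0 : 0 ≤ l2 (fun U => ∑ i, a i * F i U) (fun U => ∑ i, a i * F i U) := l2_self_nonneg_lat _
    have hout0 := l2_self_nonneg_lat (fun U => Real.sin (innerPhase (δ β) U) * ∑ i, a i * e i U)
    refine ⟨hnin0, by linarith, ?_⟩
    have hE0 : 0 ≤ Real.exp (-((levelGap k + 1) * bareLambda ((L : ℝ) ^ 3 * β))) * levelValue su2Rep L β 0 := by positivity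
    have hout_eq : l2 (fun U => Real.sin (innerPhase (δ β) U) * ∑ i, a i * e i U) (fun U => Real.sin (innerPhase (δ β) U) * ∑ i, a i * e i U)
        = ∑ i, a i ^ 2 - l2 (fun U => ∑ i, a i * F i U) (fun U => ∑ i, a i * F i U) := by linarith [hsplit]
    have h3 := hVal.trans (mul_le_mul_of_nonneg_left (hvalout.trans hout_eq.le) hE0)
    have h4 := mul_le_mul_of_nonneg_right herr (Finset.sum_nonneg fun i (_ : i ∈ Finset.univ) => sq_nonneg (a i))
    have h5 : levelValue su2Rep L β k * ∑ i, a i ^ 2 ≤ qform su2Rep β (fun U => ∑ i, a i * F i U) (fun U => ∑ i, a i * F i U)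
        + Real.exp (-((levelGap k + 1) * bareLambda ((L : ℝ) ^ 3 * β))) * levelValue su2Rep L β 0 *
            (∑ i, a i ^ 2 - l2 (fun U => ∑ i, a i * F i U) (fun U => ∑ i, a i * F i U))
        + min (ε / 8) (1 / 8) * bareLambda ((L : ℝ) ^ 3 * β) * levelValue su2Rep L β 0 * ∑ i, a i ^ 2 := by
      linarith [honion, h3, h4, hfloorK]
    have h6 := mul_le_mul_of_nonneg_right h5 hμ0.le
    linarith [h6]
  -- nondegeneracy of the inner Gram matrix
  have hGram : ∀ a : Fin (k + 1) → ℝ, a ≠ 0 → 0 < l2 (fun U => ∑ i, a i * F i U) (fun U => ∑ i, a i * F i U) := by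
    intro a ha
    obtain ⟨hnin0, -, hkey⟩ := key a
    have hn : 0 < ∑ i, a i ^ 2 := sum_sq_pos_of_ne_zero ha
    rcases hnin0.lt_or_eq with hpos | hzero
    · exact hpos
    · exfalso
      have hq0 : qform su2Rep β (fun U => ∑ i, a i * F i U) (fun U => ∑ i, a i * F i U) ≤ 0 := by
        have h := qform_le_latCE_mul_l2 hβ0.le (isPhys_sum_mul_lat Finset.univ F hFphys a)
        rw [← hzero, mul_zero] at h; exact h
      rw [← hzero] at hkey
      exact absurd (gram_endgame hn hΛ0 hμ0.le hq0 hkey hB) (not_le.mpr H)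
  -- INNER NO-INTRUDER supplies a good combination; the endgame contradicts `H`
  obtain ⟨a, ha, hIa⟩ := hI' β hβI F hFphys hFsupp hGram
  obtain ⟨hnin0, hnin1, hkey⟩ := key a
  exact absurd (bo_endgame (sum_sq_pos_of_ne_zero ha) hnin0 hnin1 hΛ0 hkey hIa hA hB) (not_le.mpr H)

/-! ## §5 COARSE-UPPER(L) -/

/-- ★★★ **COARSE-UPPER(L) from VALLEY GAIN + INNER NO-INTRUDER** (conclusion = VERBATIM the body of KTR's `CoarseNoIntruderAt L`, = hypothesis
`hUp` of `TwoLattice.Base.fixedLatticeTraceLaw_of_coarse`; `L = 2` is stub 3b′): the glue `boUpper_of_valley_inner`, the tree's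
`BOHandover.coarseNoIntruderAt_of_boUpper`, and crux ONE (`oneSiteLevels_proof`, closed). [cite: Luscher1983, §3] [cite: LuscherMunster1984, §2] -/
theorem coarseNoIntruderAt_of_valley_inner {δ η : ℝ → ℝ} (hS : ScalesAdmissible L δ η) (hV : ValleyGainAt L δ η)
    (hI : InnerNoIntruderAt L δ) :
    ∀ k : ℕ, ∀ d : ℝ, d < levelGap k → ∃ lam0 : ℝ, 0 < lam0 ∧ ∀ lam : ℝ, 0 < lam → lam ≤ lam0 →
      ∀ β : ℝ, InFemtoWindow lam β L →
        levelValue su2Rep L β k ≤ Real.exp (-(d * luscherLambda β L) / L) * levelValue su2Rep L β 0 :=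
  BOHandover.coarseNoIntruderAt_of_boUpper L (boUpper_of_valley_inner hS hV hI) oneSiteLevels_proof

end Summit.QuantumFields.YangMills.Theorems.FemtoTransferGap

end
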